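import Summits.KontsevichZagierPeriods.KontsevichZagierPeriods.Theorems.RootDecompWalshStrataConicCneg

/-!
# Root decomposition & Walsh strata — conic-wall SECTIONS, part 1: the height set (gen 8, §37)

Route `RootDecompWalshStrata`, leaf `QuadricBakerDescent` (stmt-27597), residual R-E2 (NODE.md, decomp-kz-lens-4).
The bookkeeping that feeds a boundary section `(S, ζ)` of a sector piece lying on an adapted conic wall
`a(κ₀X² + κ₁Y²) + c = (l₀ + l₁X + l₂Y)²` into the height reparametrisation `InBaker.psection_height`:
(1) along the wall `(kX − l₁L(Y))² = δ(Y)` (`ConicWall.sq_of_wall`), so the sign of `E = kX − l₁L(Y)`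
names the branch `X = X_ε(Y)` carrying the section point (`ConicWall.Xb_of_branch`), and `E = 0` only at
the finitely many roots of `δ` (`ConicWall.finite_δ_roots`); (2) the HEIGHT SET
`T₀ = {Y : δ > 0, X_ε > 0, 0 ≤ Y ≤ hi, slope(Y) ∈ A, ζ(slope(Y)) = ‖(X_ε(Y), Y)‖_κ}` is `ℚ`-semialgebraic
— two graph eliminations (Tarski–Seidenberg, `isSemialgebraic_sep_snoc_mem`) through the graph of `ζ`
(`ConicWall.isSemialgebraic_heightSet`).  Part 2 proves `InBaker.psection_conic`.  §37.0 (v11) makes the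
terminal SIGN-FREE in `c`: `R₄ ≠ 0` wherever `δ ≥ 0` as soon as `κ₁ > 0` and the wall misses the centre
(`ConicWall.aeval_R4Y_ne_zero_of_centre`, from the identity `Λ_ε² − c = a·Q(wall point)`), whence
`InBaker.conic_height_gen` (`c < 0`, or: off-centre wall, `κ₁ > 0`, no double-root radicand).
[KontsevichZagier2001 §1.2 rule (2); BCR1998 §2.2; this node]
-/

noncomputable section

open Set MeasureTheory Literature.NumberTheory.Transcendental
open Literature.ModelTheory.ExponentialFields (IsSemialgebraic isSemialgebraic_univ
  tarski_seidenberg_real_holds)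

namespace Summit.KontsevichZagierPeriods.RootDecompWalshStrata.ConicDescent

/-! #### 37.0 The sign-free hull: `R₄ ≠ 0` off the centre -/

namespace ConicWall

variable (W : ConicWall)

/-- The KEY IDENTITY behind `R₄ = k⁴(Λ² − c)(Λ̄² − c)`: with `u² = δ(Y)`,
`(P + εl₁u)² − ck² = a·(κ₀(l₁L + εu)² + κ₁(kY)²) = a k²·Q(X_ε(Y), Y)` — `Λ_ε² − c = a·Q` at the wall
point (`Λ_ε` is the value of the affine form there, `Λ² = D = aQ + c`). [this node] -/
theorem factor_eq (ε u y : ℝ) (hε : ε ^ 2 = 1) (hu : u ^ 2 = W.δ y) :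
    (W.P y + ε * W.l₁ * u) ^ 2 - W.c * (W.k : ℝ) ^ 2 =
      W.a * (W.κ₀ * (W.l₁ * W.L y + ε * u) ^ 2 + W.κ₁ * ((W.k : ℝ) * y) ^ 2) := by
  simp only [P, δ, k, L] at hu ⊢
  push_cast at hu ⊢
  linear_combination (-((W.a : ℝ) * W.κ₀ - W.l₁ ^ 2)) * ε ^ 2 * hu +
    (-((W.a : ℝ) * W.κ₀ - W.l₁ ^ 2) * ((W.a : ℝ) * W.κ₀ * (W.l₀ + W.l₂ * y) ^ 2 -
      ((W.a : ℝ) * W.κ₀ - W.l₁ ^ 2) * (W.a * W.κ₁ * y ^ 2 + W.c))) * hε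

/-- **`R₄ ≠ 0` wherever `δ ≥ 0`, for ANY sign of `c`**, as soon as `κ₁ > 0` and the wall misses the
centre (`l₀² ≠ c`): by `factor_eq` each factor of `R₄` is `a k²·Q` at a branch point, and `Q = 0` only at
the centre, which lies on the wall iff `l₀² = c`. [this node] -/
theorem aeval_R4Y_ne_zero_of_centre (hk : W.k ≠ 0) (ha : W.a ≠ 0) (hκ : 0 < W.κ₀ ∧ 0 < W.κ₁)
    (hl₀ : W.l₀ ^ 2 ≠ W.c) (y : ℝ) (hδ : 0 ≤ W.δ y) : Polynomial.aeval y W.R4Y ≠ 0 := by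
  have hk' : (W.k : ℝ) ≠ 0 := by exact_mod_cast hk
  have ha' : (W.a : ℝ) ≠ 0 := by exact_mod_cast ha
  have hκ0 : (0 : ℝ) < W.κ₀ := by exact_mod_cast hκ.1
  have hκ1 : (0 : ℝ) < W.κ₁ := by exact_mod_cast hκ.2
  rw [W.aeval_R4Y y hδ]
  set u := √(W.δ y) with hu_def
  have hu : u ^ 2 = W.δ y := by rw [hu_def]; exact Real.sq_sqrt hδ
  -- each factor is `a·Q_ε` with `Q_ε > 0`
  have hQ : ∀ ε : ℝ, ε ^ 2 = 1 →
      0 < (W.κ₀ : ℝ) * (W.l₁ * W.L y + ε * u) ^ 2 + W.κ₁ * ((W.k : ℝ) * y) ^ 2 := by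
    intro ε hε
    have h1 : 0 ≤ (W.κ₀ : ℝ) * (W.l₁ * W.L y + ε * u) ^ 2 := mul_nonneg hκ0.le (sq_nonneg _)
    have h2 : 0 ≤ (W.κ₁ : ℝ) * ((W.k : ℝ) * y) ^ 2 := mul_nonneg hκ1.le (sq_nonneg _)
    rcases (add_nonneg h1 h2).lt_or_eq with h | h
    · exact h
    exfalso
    have e2' : (W.κ₁ : ℝ) * ((W.k : ℝ) * y) ^ 2 = 0 := by linarith
    have e2 : ((W.k : ℝ) * y) ^ 2 = 0 := by
      rcases mul_eq_zero.1 e2' with h3 | h3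
      · exact absurd h3 hκ1.ne'
      · exact h3
    have hy : y = 0 := by
      rcases mul_eq_zero.1 (pow_eq_zero_iff two_ne_zero |>.1 e2) with h3 | h3
      · exact absurd h3 hk'
      · exact h3
    have e1' : (W.κ₀ : ℝ) * (W.l₁ * W.L y + ε * u) ^ 2 = 0 := by linarith
    have e1 : (W.l₁ * W.L y + ε * u) ^ 2 = 0 := by
      rcases mul_eq_zero.1 e1' with h3 | h3
      · exact absurd h3 hκ0.ne'
      · exact h3
    have e3 : (W.l₁ : ℝ) * W.L y + ε * u = 0 := pow_eq_zero_iff two_ne_zero |>.1 e1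
    have e4 : u ^ 2 = W.l₁ ^ 2 * W.l₀ ^ 2 := by
      have e5 : ε * u = -(W.l₁ * W.L y) := by linarith
      have e6 : (ε * u) ^ 2 = (W.l₁ * W.L y) ^ 2 := by rw [e5, neg_sq]
      rw [mul_pow, hε, one_mul] at e6
      rw [e6, L, hy, mul_zero, add_zero, mul_pow]
    rw [hu] at e4
    simp only [δ, L, k, hy] at e4
    push_cast at e4
    have e7 : ((W.a : ℝ) * W.κ₀ - W.l₁ ^ 2) * (W.l₀ ^ 2 - W.c) = 0 := by linear_combination e4
    rcases mul_eq_zero.1 e7 with h3 | h3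
    · exact hk' (by simp only [k]; push_cast; exact h3)
    · exact hl₀ (by exact_mod_cast (sub_eq_zero.1 h3))
  have f1 := W.factor_eq 1 u y (by norm_num) hu
  have f2 := W.factor_eq (-1) u y (by norm_num) hu
  rw [show W.P y + W.l₁ * u = W.P y + 1 * W.l₁ * u by ring,
    show W.P y - W.l₁ * u = W.P y + (-1) * W.l₁ * u by ring, f1, f2]
  exact mul_ne_zero (mul_ne_zero ha' (hQ 1 (by norm_num)).ne')
    (mul_ne_zero ha' (hQ (-1) (by norm_num)).ne')

end ConicWall

/-- One monotone half of the sign-free terminal (as `InBaker.conic_height_cneg_half`, with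
`aeval_R4Y_ne_zero_of_centre` feeding `exists_rat_hull`; the double-root radicand excluded). -/
theorem InBaker.conic_height_free_half (W : ConicWall) (γ ε : ℚ) (hε : ε = 1 ∨ ε = -1)
    (hk : W.k ≠ 0) (ha : W.a ≠ 0) (hκ : 0 < W.κ₀ ∧ 0 < W.κ₁) (hl₀ : W.l₀ ^ 2 ≠ W.c)
    (hh : W.δe ≠ 0 → W.δg - W.δf ^ 2 / (4 * W.δe) ≠ 0) (p q : ℚ)
    (hmono : MonotoneOn W.δ (Icc (p : ℝ) q) ∨ AntitoneOn W.δ (Icc (p : ℝ) q))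
    (r : KZ.IntegralRep 1) (hdom : ∀ v ∈ r.domain, (p : ℝ) ≤ v 0 ∧ v 0 ≤ q)
    (hδ : ∀ v ∈ r.domain, 0 < W.δ (v 0))
    (hr : EqOn r.integrand (BallCube.pheight W.κ₀ W.κ₁ γ W.a W.c (W.Xb ε) (W.Xb' ε)) r.domain) :
    InBaker (KZ.of r) := by
  rcases r.domain.eq_empty_or_nonempty with h0 | ⟨v₀, hv₀⟩
  · exact InBaker.of_domain_eq_empty r h0
  obtain ⟨lo, hi, hD, hR4⟩ := exists_rat_hull p q W.δ (fun x => Polynomial.aeval x W.R4Y)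
    W.continuous_δ (Polynomial.continuous_aeval W.R4Y) hmono
    (fun y _ hy => W.aeval_R4Y_ne_zero_of_centre hk ha hκ hl₀ y hy) {y | ∃ v ∈ r.domain, v 0 = y}
    (fun y ⟨v, hv, hvy⟩ => hvy ▸ ⟨(hdom v hv).1, (hdom v hv).2⟩)
    (fun y ⟨v, hv, hvy⟩ => hvy ▸ hδ v hv) ⟨v₀ 0, v₀, hv₀, rfl⟩
  exact InBaker.conic_height_all W γ ε hε hk ha ⟨hκ.1, hκ.2.le⟩ hh lo hi hR4 r
    (fun v hv => hD (v 0) ⟨v, hv, rfl⟩) hδ hr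

/-- The sign-free terminal off the centre: split the heights at the vertex of `δ`. -/
theorem InBaker.conic_height_free (W : ConicWall) (γ ε : ℚ) (hε : ε = 1 ∨ ε = -1) (hk : W.k ≠ 0)
    (ha : W.a ≠ 0) (hκ : 0 < W.κ₀ ∧ 0 < W.κ₁) (hl₀ : W.l₀ ^ 2 ≠ W.c)
    (hh : W.δe ≠ 0 → W.δg - W.δf ^ 2 / (4 * W.δe) ≠ 0) (lo hi : ℚ)
    (r : KZ.IntegralRep 1) (hdom : ∀ v ∈ r.domain, (lo : ℝ) ≤ v 0 ∧ v 0 ≤ hi)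
    (hδ : ∀ v ∈ r.domain, 0 < W.δ (v 0))
    (hr : EqOn r.integrand (BallCube.pheight W.κ₀ W.κ₁ γ W.a W.c (W.Xb ε) (W.Xb' ε)) r.domain) :
    InBaker (KZ.of r) := by
  refine InBaker.of_split_at W.mδ r (fun r₁ hd₁ hi₁ => ?_) (fun r₁ hd₁ hi₁ => ?_)
  · refine InBaker.conic_height_free_half W γ ε hε hk ha hκ hl₀ hh W.mδ hi
      ((W.δ_mono_Ici).imp (fun h => h.mono fun x hx => hx.1) fun h => h.mono fun x hx => hx.1)
      r₁ (fun v hv => ?_) (fun v hv => ?_) fun v hv => ?_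
    · rw [hd₁] at hv
      exact ⟨hv.2.le, (hdom v hv.1).2⟩
    · rw [hd₁] at hv
      exact hδ v hv.1
    · have hv' : v ∈ r.domain := by rw [hd₁] at hv; exact hv.1
      rw [hi₁]
      exact hr hv'
  · refine InBaker.conic_height_free_half W γ ε hε hk ha hκ hl₀ hh lo W.mδ
      ((W.δ_mono_Iic).imp (fun h => h.mono fun x hx => hx.2) fun h => h.mono fun x hx => hx.2)
      r₁ (fun v hv => ?_) (fun v hv => ?_) fun v hv => ?_
    · rw [hd₁] at hv
      exact ⟨(hdom v hv.1).1, hv.2.le⟩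
    · rw [hd₁] at hv
      exact hδ v hv.1
    · have hv' : v ∈ r.domain := by rw [hd₁] at hv; exact hv.1
      rw [hi₁]
      exact hr hv'

/-- **CONIC-WALL HEIGHT TERMINAL, NO `R₄` HYPOTHESIS**: `c < 0` (every stratum, `InBaker.conic_height_cneg`)
OR `κ₁ > 0`, the wall misses the centre and the radicand is not a double root (`InBaker.conic_height_free`).
[KontsevichZagier2001 §1.2; this node] -/
theorem InBaker.conic_height_gen (W : ConicWall) (γ ε : ℚ) (hε : ε = 1 ∨ ε = -1) (hk : W.k ≠ 0)
    (ha : W.a ≠ 0) (hκ : 0 < W.κ₀ ∧ 0 ≤ W.κ₁)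
    (hc : W.c < 0 ∨ (0 < W.κ₁ ∧ W.l₀ ^ 2 ≠ W.c ∧ (W.δe ≠ 0 → W.δg - W.δf ^ 2 / (4 * W.δe) ≠ 0)))
    (lo hi : ℚ) (r : KZ.IntegralRep 1) (hdom : ∀ v ∈ r.domain, (lo : ℝ) ≤ v 0 ∧ v 0 ≤ hi)
    (hδ : ∀ v ∈ r.domain, 0 < W.δ (v 0))
    (hr : EqOn r.integrand (BallCube.pheight W.κ₀ W.κ₁ γ W.a W.c (W.Xb ε) (W.Xb' ε)) r.domain) :
    InBaker (KZ.of r) := by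
  rcases hc with hc | ⟨hκ₁, hl₀, hh⟩
  · exact InBaker.conic_height_cneg W γ ε hε hk ha hκ hc lo hi r hdom hδ hr
  · exact InBaker.conic_height_free W γ ε hε hk ha ⟨hκ.1, hκ₁⟩ hl₀ hh lo hi r hdom hδ hr

/-! #### 37.1 Pointwise facts along an adapted conic wall -/

namespace ConicWall

variable (W : ConicWall)

/-- Along the wall, `(kX − l₁L(Y))² = δ(Y)` (the wall as a quadratic in `X`). [this node] -/
theorem sq_of_wall (X Y : ℝ)
    (h : (W.a : ℝ) * (W.κ₀ * X ^ 2 + W.κ₁ * Y ^ 2) + W.c = (W.l₀ + W.l₁ * X + W.l₂ * Y) ^ 2) :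
    (W.k * X - W.l₁ * W.L Y) ^ 2 = W.δ Y := by
  simp only [k, L, δ]
  push_cast
  linear_combination ((W.a : ℝ) * W.κ₀ - W.l₁ ^ 2) * h

/-- If `ε(kX − l₁L(Y)) = √δ(Y)` then `X = X_ε(Y)`: the point lies on branch `ε`. [this node] -/
theorem Xb_of_branch (ε : ℚ) (hε : ε = 1 ∨ ε = -1) (hk : W.k ≠ 0) (X Y : ℝ)
    (h : (ε : ℝ) * (W.k * X - W.l₁ * W.L Y) = √(W.δ Y)) : W.Xb ε Y = X := by
  have hk' : (W.k : ℝ) ≠ 0 := by exact_mod_cast hk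
  have hε2 : (ε : ℝ) * ε = 1 := by rcases hε with rfl | rfl <;> norm_num
  rw [Xb, ← h, div_eq_iff hk']
  linear_combination (W.k * X - W.l₁ * W.L Y) * hε2

/-- A non-zero radicand has finitely many real roots. [folklore] -/
theorem finite_δ_roots (hnd : W.δe ≠ 0 ∨ W.δf ≠ 0 ∨ W.δg ≠ 0) : {y : ℝ | W.δ y = 0}.Finite := by
  set p : Polynomial ℝ := Polynomial.C (W.δe : ℝ) * Polynomial.X ^ 2 +
    Polynomial.C (W.δf : ℝ) * Polynomial.X + Polynomial.C (W.δg : ℝ) with hp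
  have hp0 : p ≠ 0 := by
    intro h
    have h2 := congrArg (fun p : Polynomial ℝ => p.coeff 2) h
    have h1 := congrArg (fun p : Polynomial ℝ => p.coeff 1) h
    have h0 := congrArg (fun p : Polynomial ℝ => p.coeff 0) h
    simp [hp, Polynomial.coeff_X] at h2 h1 h0
    tauto
  refine (Polynomial.finite_setOf_isRoot hp0).subset fun y hy => ?_
  simp only [mem_setOf_eq] at hy ⊢
  rw [W.δ_eq_qD, qD] at hy
  simp only [Polynomial.IsRoot, hp, Polynomial.eval_add, Polynomial.eval_mul, Polynomial.eval_C,
    Polynomial.eval_pow, Polynomial.eval_X]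
  exact hy

/-- `X_ε` of a coordinate is semialgebraic (any ambient dimension). [this node] -/
theorem isSemialgebraicFunOn_Xb_coord (ε : ℚ) (hk : W.k ≠ 0) {n : ℕ} {T : Set (Fin n → ℝ)}
    (hT : IsSemialgebraic ℚ T) (i : Fin n) : IsSemialgebraicFunOn ℚ T fun v => W.Xb ε (v i) := by
  have h0 := isSemialgebraicFunOn_apply hT i
  have hδ : IsSemialgebraicFunOn ℚ T fun v => W.δ (v i) :=
    ((((isSemialgebraicFunOn_ratCast hT W.δe).mul_holds (h0.mul_holds h0)).add_holds
      ((isSemialgebraicFunOn_ratCast hT W.δf).mul_holds h0)).add_holds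
      (isSemialgebraicFunOn_ratCast hT W.δg)).congr fun v _ => by
      simp only [Pi.add_apply, Pi.mul_apply]
      rw [W.δ_eq_qD, qD]
      ring
  have hL : IsSemialgebraicFunOn ℚ T fun v => W.L (v i) :=
    ((isSemialgebraicFunOn_ratCast hT W.l₀).add_holds
      ((isSemialgebraicFunOn_ratCast hT W.l₂).mul_holds h0)).congr fun v _ => by
      simp only [Pi.add_apply, Pi.mul_apply, L]
  exact ((((isSemialgebraicFunOn_ratCast hT W.l₁).mul_holds hL).add_holds
    ((isSemialgebraicFunOn_ratCast hT ε).mul_holds (IsSemialgebraicFunOn.sqrt_holds hδ))).div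
    (isSemialgebraicFunOn_ratCast hT W.k) fun v _ => by exact_mod_cast hk).congr fun v _ => by
    simp only [Pi.add_apply, Pi.mul_apply, Xb]

/-! #### 37.2 The height set of a section on branch `ε` -/

/-- Auxiliary step `snoc2_zero''`. [bookkeeping] -/
private theorem snoc2_zero'' (x : Fin 1 → ℝ) (t : ℝ) : (Fin.snoc x t : Fin 2 → ℝ) 0 = x 0 := rfl
/-- Auxiliary step `snoc2_one''`. [bookkeeping] -/
private theorem snoc2_one'' (x : Fin 1 → ℝ) (t : ℝ) : (Fin.snoc x t : Fin 2 → ℝ) 1 = t := rfl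
/-- Auxiliary step `snoc3_one`. [bookkeeping] -/
private theorem snoc3_one (z : Fin 2 → ℝ) (t : ℝ) : (Fin.snoc z t : Fin 3 → ℝ) 1 = z 1 := rfl
/-- Auxiliary step `snoc3_two`. [bookkeeping] -/
private theorem snoc3_two (z : Fin 2 → ℝ) (t : ℝ) : (Fin.snoc z t : Fin 3 → ℝ) 2 = t := rfl

/-- **THE HEIGHT SET IS SEMIALGEBRAIC.**  For a semialgebraic `A ⊆ ℝ¹` and a semialgebraic `ζ` on
`A`, the set of heights `Y` with `δ(Y) > 0`, `X_ε(Y) > 0`, `0 ≤ Y ≤ hi`, whose slope `Y/X_ε(Y)` lies in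
`A` and at which `ζ(slope) = √(κ₀X_ε(Y)² + κ₁Y²)`, is `ℚ`-semialgebraic: two graph eliminations through
the graph of `ζ` (Tarski–Seidenberg). [BCR1998 Thm. 2.2.1; this node] -/
theorem isSemialgebraic_heightSet (ε hi : ℚ) (hk : W.k ≠ 0) {A : Set (Fin 1 → ℝ)}
    (ζ : (Fin 1 → ℝ) → ℝ) (hζ : IsSemialgebraicFunOn ℚ A ζ) :
    IsSemialgebraic ℚ {v : Fin 1 → ℝ |
      (0 < W.δ (v 0) ∧ 0 < W.Xb ε (v 0) ∧ 0 ≤ v 0 ∧ v 0 ≤ (hi : ℝ)) ∧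
      lift₁ (fun s => s / W.Xb ε s) v ∈ A ∧
      ζ (lift₁ (fun s => s / W.Xb ε s) v) =
        √(W.κ₀ * W.Xb ε (v 0) ^ 2 + W.κ₁ * v 0 ^ 2)} := by
  -- the base set `U`
  have hU : IsSemialgebraic ℚ {v : Fin 1 → ℝ |
      0 < W.δ (v 0) ∧ 0 < W.Xb ε (v 0) ∧ 0 ≤ v 0 ∧ v 0 ≤ (hi : ℝ)} := by
    have huniv : IsSemialgebraic ℚ (univ : Set (Fin 1 → ℝ)) := isSemialgebraic_univ
    have h1 : IsSemialgebraic ℚ {v : Fin 1 → ℝ | v ∈ univ ∧ 0 < W.δ (v 0)} :=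
      IsSemialgebraicFunOn.isSemialgebraic_sep_pos
        ((isSemialgebraicFunOn_qD W.δe W.δf W.δg huniv).congr fun v _ => by rw [W.δ_eq_qD])
    have h2 : IsSemialgebraic ℚ {v : Fin 1 → ℝ | v ∈ {v : Fin 1 → ℝ | v ∈ univ ∧ 0 < W.δ (v 0)} ∧
        0 < W.Xb ε (v 0)} :=
      IsSemialgebraicFunOn.isSemialgebraic_sep_pos (W.isSemialgebraicFunOn_Xb_coord ε hk h1 0)
    have h3 : IsSemialgebraic ℚ {v : Fin 1 → ℝ | v ∈ {v : Fin 1 → ℝ |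
        v ∈ {v : Fin 1 → ℝ | v ∈ univ ∧ 0 < W.δ (v 0)} ∧ 0 < W.Xb ε (v 0)} ∧ 0 ≤ v 0 - ((0 : ℚ) : ℝ)} :=
      IsSemialgebraicFunOn.isSemialgebraic_sep_nonneg
        ((isSemialgebraicFunOn_apply h2 0).sub_holds (isSemialgebraicFunOn_ratCast h2 0))
    have h4 : IsSemialgebraic ℚ {v : Fin 1 → ℝ | v ∈ {v : Fin 1 → ℝ | v ∈ {v : Fin 1 → ℝ |
        v ∈ {v : Fin 1 → ℝ | v ∈ univ ∧ 0 < W.δ (v 0)} ∧ 0 < W.Xb ε (v 0)} ∧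
          0 ≤ v 0 - ((0 : ℚ) : ℝ)} ∧ 0 ≤ (hi : ℝ) - v 0} :=
      IsSemialgebraicFunOn.isSemialgebraic_sep_nonneg
        ((isSemialgebraicFunOn_ratCast h3 hi).sub_holds (isSemialgebraicFunOn_apply h3 0))
    convert h4 using 1
    ext v
    simp only [mem_setOf_eq, mem_univ, true_and, Rat.cast_zero, sub_zero, sub_nonneg]
    tauto
  -- the graph of `ζ`, pulled back to `ℝ³` along `w ↦ (w 1, w 2)`
  have hG : IsSemialgebraic ℚ {z : Fin 2 → ℝ | ∃ x ∈ A, z = Fin.snoc x (ζ x)} := hζ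
  have hT2 := hG.preimage_comp (![1, 2] : Fin 2 → Fin 3)
  -- the norm `√(κ₀X_ε(Y)² + κ₁Y²)` as a function on `ℝ²` (of the first coordinate)
  have huniv2 : IsSemialgebraic ℚ (univ : Set (Fin 2 → ℝ)) := isSemialgebraic_univ
  have hX2 := W.isSemialgebraicFunOn_Xb_coord ε hk huniv2 0
  have h02 := isSemialgebraicFunOn_apply huniv2 (0 : Fin 2)
  have hNm : IsSemialgebraicFunOn ℚ (univ : Set (Fin 2 → ℝ)) fun z =>
      √(W.κ₀ * W.Xb ε (z 0) ^ 2 + W.κ₁ * z 0 ^ 2) :=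
    (IsSemialgebraicFunOn.sqrt_holds ((((isSemialgebraicFunOn_ratCast huniv2 W.κ₀).mul_holds
      (hX2.mul_holds hX2)).add_holds ((isSemialgebraicFunOn_ratCast huniv2 W.κ₁).mul_holds
      (h02.mul_holds h02))))).congr fun z _ => by
      simp only [Pi.add_apply, Pi.mul_apply]
      ring_nf
  have hT1 := IsSemialgebraicFunOn.isSemialgebraic_sep_snoc_mem tarski_seidenberg_real_holds hNm hT2
  -- the slope as a function on `U`
  have hφ : IsSemialgebraicFunOn ℚ {v : Fin 1 → ℝ |
      0 < W.δ (v 0) ∧ 0 < W.Xb ε (v 0) ∧ 0 ≤ v 0 ∧ v 0 ≤ (hi : ℝ)} fun v => v 0 / W.Xb ε (v 0) :=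
    (isSemialgebraicFunOn_apply hU 0).div (W.isSemialgebraicFunOn_Xb_coord ε hk hU 0)
      fun v hv => hv.2.1.ne'
  have hT0 := IsSemialgebraicFunOn.isSemialgebraic_sep_snoc_mem tarski_seidenberg_real_holds hφ hT1
  convert hT0 using 1
  ext v
  simp only [mem_setOf_eq, mem_univ, true_and, mem_preimage]
  constructor
  · rintro ⟨hU', hA', hζ'⟩
    refine ⟨hU', lift₁ (fun s => s / W.Xb ε s) v, hA', ?_⟩
    funext j
    fin_cases j
    · simp [snoc3_one]
    · simp [snoc3_two, hζ']
  · rintro ⟨hU', x, hxA, hx⟩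
    have h0 := congrFun hx 0
    have h1 := congrFun hx 1
    simp only [Function.comp_apply, Matrix.cons_val_zero, Matrix.cons_val_one, snoc3_one, snoc3_two, snoc2_zero'', snoc2_one''] at h0 h1
    have hx' : lift₁ (fun s => s / W.Xb ε s) v = x := by
      funext j
      have hj := Fin.eq_zero j
      subst hj
      rw [lift₁_apply, h0]
    rw [hx']
    exact ⟨hU', hxA, h1.symm⟩

end ConicWall

end Summit.KontsevichZagierPeriods.RootDecompWalshStrata.ConicDescent

end
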